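import Summits.NavierStokesRegularity.NavierStokesRegularity.Theses.SlicedKelvin
import Literature.Analysis.FluidPDE.CollapseDebris
import HarnessLib

/-!
# Stub `stub_fluxSlicing` of the birth line of crux `SlicedKelvin.PlanarFluxLiouville`

(crux item `stmt-NavierStokesRegularity-15601`, line `registered` =
`Cruxes/PlanarFluxLiouville/Lines/birth.lean`.)

The kinematic entrance stub of the skeleton (pure measure theory, no PDE, no regularity hypothesis
on the field): if the vorticity `w = curl u` of a field `u : ℝ³ → ℝ³` has unsigned flux at most `M`
through EVERY plane `R {x₂ = c}` (`R` a linear isometry of `ℝ³`), then it has the Giga–Miyakawa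
critical Morrey density bound `∫_{B_r(x)} |curl u| ≤ 6 M r` on every ball.

Proof (three coordinate foliations + Tonelli):
* `‖w‖ ≤ |w₀| + |w₁| + |w₂|` pointwise (`ℓ² ≤ ℓ¹` on `ℝ³`);
* the ball `B_r(x)` lies in each coordinate slab `{z | zᵢ ∈ (xᵢ - r, xᵢ + r)}`;
* the slab integral of `|wᵢ|` is `∫_{c ∈ (xᵢ-r, xᵢ+r)} (flux of |wᵢ| through {zᵢ = c}) dc ≤ 2 r M`,
  by Tonelli through the measure-preserving parametrisation
  `(c, y) ↦ Rᵢ (y₀, y₁, c)` of `ℝ³` by `ℝ × ℝ²`, where `Rᵢ` is the coordinate-swap isometry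
  exchanging the axes `i` and `2` (so `Rᵢ e₂ = eᵢ` and the plane integral is literally the
  hypothesis at `R = Rᵢ`);
* summing the three slabs gives `3 · 2 r M = 6 M r` (and `0` if `M < 0`).
`curl u` is Borel measurable for every `u` (`Literature.Analysis.FluidPDE.measurable_curl`), which
is all the measurability Tonelli needs.

No auxiliary constants are introduced: the horizontal-plane parametrisation of `ℝ³` is written
`WithLp.toLp 2 ![p.2 0, p.2 1, p.1]` for `p : ℝ × ℝ²` (height `c = p.1`, in-plane
coordinates `y = p.2`; this is the point `WithLp.toLp 2 ![y 0, y 1, c]` of the crux statement),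
and the coordinate swap `Rᵢ` is Mathlib's `LinearIsometryEquiv.piLpCongrLeft 2 ℝ ℝ (Equiv.swap i 2)`.
-/

noncomputable section

open MeasureTheory Set
open Literature.Analysis.FluidPDE

-- single-conjunct summit: `<Summit>.<Problem>` repeats the name (tree-wide convention, lakefile weak option)
set_option linter.dupNamespace false

namespace Summit.NavierStokesRegularity.NavierStokesRegularity.Theorems.PlanarFluxLiouville.Birth

/-! ## The slicing maps -/

/-- The plane parametrisation `p ↦ (y₀, y₁, c)` (`c = p.1`, `y = p.2`) is Mathlib's coordinate
insertion `Fin.insertNth 2` transported along `toLp`/`ofLp`. -/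
theorem plane_eq (p : ℝ × EuclideanSpace ℝ (Fin 2)) :
    (WithLp.toLp 2 ![p.2 0, p.2 1, p.1] : EuclideanSpace ℝ (Fin 3)) = WithLp.toLp 2
      ((MeasurableEquiv.piFinSuccAbove (fun _ : Fin 3 => ℝ) 2).symm (p.1, WithLp.ofLp p.2)) := by
  rw [MeasurableEquiv.piFinSuccAbove_symm_apply]
  congr 1
  funext j
  fin_cases j <;> rfl

/-- The plane parametrisation `ℝ × ℝ² → ℝ³`, `(c, y) ↦ (y₀, y₁, c)`, preserves Lebesgue measure
(it is a composition of the volume-preserving `ofLp`, `Fin.insertNth` and `toLp`). -/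
theorem measurePreserving_plane :
    MeasurePreserving
      (fun p : ℝ × EuclideanSpace ℝ (Fin 2) =>
        (WithLp.toLp 2 ![p.2 0, p.2 1, p.1] : EuclideanSpace ℝ (Fin 3)))
      (volume : Measure (ℝ × EuclideanSpace ℝ (Fin 2))) (volume : Measure (EuclideanSpace ℝ (Fin 3))) := by
  have h1 : MeasurePreserving
      (Prod.map (id : ℝ → ℝ) (WithLp.ofLp : EuclideanSpace ℝ (Fin 2) → (Fin 2 → ℝ)))
      (volume : Measure (ℝ × EuclideanSpace ℝ (Fin 2)))
      ((volume : Measure ℝ).prod (volume : Measure (Fin 2 → ℝ))) :=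
    (MeasurePreserving.id volume).prod (PiLp.volume_preserving_ofLp (Fin 2))
  have h2 := (volume_preserving_piFinSuccAbove (fun _ : Fin 3 => ℝ) 2).symm
  have h3 := PiLp.volume_preserving_toLp (Fin 3)
  have h := (h3.comp h2).comp h1
  have hfun : (fun p : ℝ × EuclideanSpace ℝ (Fin 2) =>
        (WithLp.toLp 2 ![p.2 0, p.2 1, p.1] : EuclideanSpace ℝ (Fin 3))) =
      (WithLp.toLp 2 ∘ ⇑(MeasurableEquiv.piFinSuccAbove (fun _ : Fin 3 => ℝ) 2).symm)
        ∘ Prod.map (id : ℝ → ℝ) (WithLp.ofLp : EuclideanSpace ℝ (Fin 2) → (Fin 2 → ℝ)) := by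
    funext p
    exact plane_eq p
  rw [hfun]
  exact h

/-- The `i`-th coordinate of the swapped point `Rᵢ z` (`Rᵢ` = swap of the axes `i` and `2`) is `z₂`. -/
theorem swap_apply_self (i : Fin 3) (z : EuclideanSpace ℝ (Fin 3)) :
    LinearIsometryEquiv.piLpCongrLeft 2 ℝ ℝ (Equiv.swap i (2 : Fin 3)) z i = z 2 := by
  rw [LinearIsometryEquiv.piLpCongrLeft_apply, Equiv.piCongrLeft'_apply, Equiv.symm_swap,
    Equiv.swap_apply_left]

/-- The swap `Rᵢ` of the axes `i` and `2` sends `e₂` to `eᵢ`. -/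
theorem swap_single (i : Fin 3) :
    LinearIsometryEquiv.piLpCongrLeft 2 ℝ ℝ (Equiv.swap i (2 : Fin 3)) (EuclideanSpace.single 2 1) =
      EuclideanSpace.single i (1 : ℝ) := by
  rw [EuclideanSpace.piLpCongrLeft_single, Equiv.swap_apply_right]

/-- The slicing map `(c, y) ↦ Rᵢ (y₀, y₁, c)` of the `i`-th coordinate foliation preserves
Lebesgue measure. -/
theorem measurePreserving_slice (i : Fin 3) :
    MeasurePreserving
      (fun p : ℝ × EuclideanSpace ℝ (Fin 2) =>
        LinearIsometryEquiv.piLpCongrLeft 2 ℝ ℝ (Equiv.swap i (2 : Fin 3))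
          (WithLp.toLp 2 ![p.2 0, p.2 1, p.1]))
      (volume : Measure (ℝ × EuclideanSpace ℝ (Fin 2))) (volume : Measure (EuclideanSpace ℝ (Fin 3))) :=
  (LinearIsometryEquiv.piLpCongrLeft 2 ℝ ℝ (Equiv.swap i (2 : Fin 3))).measurePreserving.comp
    measurePreserving_plane

/-- The `i`-th coordinate of the sliced point `Rᵢ (y₀, y₁, c)` is the height `c`. -/
theorem slice_apply_self (i : Fin 3) (p : ℝ × EuclideanSpace ℝ (Fin 2)) :
    LinearIsometryEquiv.piLpCongrLeft 2 ℝ ℝ (Equiv.swap i (2 : Fin 3))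
      (WithLp.toLp 2 ![p.2 0, p.2 1, p.1]) i = p.1 := by
  rw [swap_apply_self]
  simp

/-! ## Plane, slab and ball integrals -/

/-- The `i`-th component of the curl of ANY field is Borel measurable, hence so is its `‖·‖ₑ`. -/
theorem measurable_enorm_curl_apply (u : EuclideanSpace ℝ (Fin 3) → EuclideanSpace ℝ (Fin 3))
    (i : Fin 3) : Measurable fun z : EuclideanSpace ℝ (Fin 3) => ‖curl u z i‖ₑ := by
  have hm : Measurable fun z : EuclideanSpace ℝ (Fin 3) => curl u z i :=
    (measurable_pi_apply i).comp ((WithLp.measurable_ofLp 2 (Fin 3 → ℝ)).comp (measurable_curl u))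
  exact hm.enorm

/-- The plane integral of `|wᵢ|` over the slice `{zᵢ = c}` is the hypothesis at `R = Rᵢ`. -/
theorem lintegral_plane_le {u : EuclideanSpace ℝ (Fin 3) → EuclideanSpace ℝ (Fin 3)} {M : ℝ}
    (hM : ∀ (R : EuclideanSpace ℝ (Fin 3) ≃ₗᵢ[ℝ] EuclideanSpace ℝ (Fin 3)) (c : ℝ),
      ∫⁻ y : EuclideanSpace ℝ (Fin 2),
          ‖inner ℝ (curl u (R (WithLp.toLp 2 ![y 0, y 1, c]))) (R (EuclideanSpace.single 2 1))‖ₑ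
        ≤ ENNReal.ofReal M)
    (i : Fin 3) (c : ℝ) :
    ∫⁻ y : EuclideanSpace ℝ (Fin 2),
        ‖curl u (LinearIsometryEquiv.piLpCongrLeft 2 ℝ ℝ (Equiv.swap i (2 : Fin 3))
          (WithLp.toLp 2 ![y 0, y 1, c])) i‖ₑ ≤ ENNReal.ofReal M := by
  have h := hM (LinearIsometryEquiv.piLpCongrLeft 2 ℝ ℝ (Equiv.swap i (2 : Fin 3))) c
  have hint : ∀ y : EuclideanSpace ℝ (Fin 2),
      ‖inner ℝ (curl u (LinearIsometryEquiv.piLpCongrLeft 2 ℝ ℝ (Equiv.swap i (2 : Fin 3))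
          (WithLp.toLp 2 ![y 0, y 1, c])))
        (LinearIsometryEquiv.piLpCongrLeft 2 ℝ ℝ (Equiv.swap i (2 : Fin 3))
          (EuclideanSpace.single 2 1))‖ₑ =
      ‖curl u (LinearIsometryEquiv.piLpCongrLeft 2 ℝ ℝ (Equiv.swap i (2 : Fin 3))
          (WithLp.toLp 2 ![y 0, y 1, c])) i‖ₑ := by
    intro y
    rw [swap_single, EuclideanSpace.inner_single_right]
    simp
  simpa only [hint] using h

/-- The slab integral: `∫_{zᵢ ∈ (a,b)} |wᵢ| ≤ M (b - a)` (Tonelli through the `i`-th slicing map). -/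
theorem lintegral_slab_le {u : EuclideanSpace ℝ (Fin 3) → EuclideanSpace ℝ (Fin 3)} {M : ℝ}
    (hM : ∀ (R : EuclideanSpace ℝ (Fin 3) ≃ₗᵢ[ℝ] EuclideanSpace ℝ (Fin 3)) (c : ℝ),
      ∫⁻ y : EuclideanSpace ℝ (Fin 2),
          ‖inner ℝ (curl u (R (WithLp.toLp 2 ![y 0, y 1, c]))) (R (EuclideanSpace.single 2 1))‖ₑ
        ≤ ENNReal.ofReal M)
    (i : Fin 3) (a b : ℝ) :
    ∫⁻ z in {z : EuclideanSpace ℝ (Fin 3) | z i ∈ Ioo a b}, ‖curl u z i‖ₑ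
      ≤ ENNReal.ofReal M * ENNReal.ofReal (b - a) := by
  have hf := measurable_enorm_curl_apply u i
  have hs : MeasurableSet {z : EuclideanSpace ℝ (Fin 3) | z i ∈ Ioo a b} :=
    measurableSet_Ioo.preimage ((measurable_pi_apply i).comp (WithLp.measurable_ofLp 2 (Fin 3 → ℝ)))
  have hΦ := measurePreserving_slice i
  rw [← hΦ.setLIntegral_comp_preimage hs hf]
  have hpre : (fun p : ℝ × EuclideanSpace ℝ (Fin 2) =>
        LinearIsometryEquiv.piLpCongrLeft 2 ℝ ℝ (Equiv.swap i (2 : Fin 3))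
          (WithLp.toLp 2 ![p.2 0, p.2 1, p.1])) ⁻¹' {z : EuclideanSpace ℝ (Fin 3) | z i ∈ Ioo a b} =
      Ioo a b ×ˢ (univ : Set (EuclideanSpace ℝ (Fin 2))) := by
    ext p
    simp [slice_apply_self]
  rw [hpre, Measure.volume_eq_prod ℝ (EuclideanSpace ℝ (Fin 2)), ← Measure.prod_restrict,
    Measure.restrict_univ]
  refine (lintegral_prod_le _).trans ?_
  refine (lintegral_mono fun c => lintegral_plane_le hM i c).trans ?_
  rw [setLIntegral_const, Real.volume_Ioo]

/-- `ℓ² ≤ ℓ¹` on `ℝ³`, in `ℝ≥0∞`: `‖z‖ₑ ≤ ‖z₀‖ₑ + ‖z₁‖ₑ + ‖z₂‖ₑ`. -/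
theorem enorm_le_enorm_apply_add (z : EuclideanSpace ℝ (Fin 3)) :
    ‖z‖ₑ ≤ ‖z 0‖ₑ + ‖z 1‖ₑ + ‖z 2‖ₑ := by
  have h : ‖z‖ ≤ ‖z 0‖ + ‖z 1‖ + ‖z 2‖ := by
    rw [EuclideanSpace.norm_eq, Fin.sum_univ_three, Real.sqrt_le_left (by positivity)]
    nlinarith [norm_nonneg (z 0), norm_nonneg (z 1), norm_nonneg (z 2)]
  calc ‖z‖ₑ = ENNReal.ofReal ‖z‖ := (ofReal_norm z).symm
    _ ≤ ENNReal.ofReal (‖z 0‖ + ‖z 1‖ + ‖z 2‖) := ENNReal.ofReal_le_ofReal h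
    _ = ‖z 0‖ₑ + ‖z 1‖ₑ + ‖z 2‖ₑ := by
        rw [ENNReal.ofReal_add (by positivity) (by positivity),
          ENNReal.ofReal_add (by positivity) (by positivity), ofReal_norm, ofReal_norm, ofReal_norm]

/-- The ball `B_r(x)` lies in the `i`-th coordinate slab of half-width `r` around `xᵢ`. -/
theorem ball_subset_slab (x : EuclideanSpace ℝ (Fin 3)) (r : ℝ) (i : Fin 3) :
    Metric.ball x r ⊆ {z : EuclideanSpace ℝ (Fin 3) | z i ∈ Ioo (x i - r) (x i + r)} := by
  intro z hz
  rw [Metric.mem_ball, dist_eq_norm] at hz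
  have h1 : ‖(z - x) i‖ ≤ ‖z - x‖ := PiLp.norm_apply_le (z - x) i
  rw [PiLp.sub_apply, Real.norm_eq_abs] at h1
  have h2 : |z i - x i| < r := h1.trans_lt hz
  rw [abs_sub_lt_iff] at h2
  simp only [mem_setOf_eq, mem_Ioo]
  constructor <;> linarith [h2.1, h2.2]

/-- Bookkeeping: `3 · (M · 2r) ≤ 6 M r` in `ℝ≥0∞` (equality for `0 ≤ M`, and `0 ≤ 0` for `M < 0`). -/
theorem three_slabs_le (M r : ℝ) (hr : 0 < r) :
    ENNReal.ofReal M * ENNReal.ofReal (2 * r) + ENNReal.ofReal M * ENNReal.ofReal (2 * r)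
        + ENNReal.ofReal M * ENNReal.ofReal (2 * r) ≤ ENNReal.ofReal (6 * M * r) := by
  by_cases hM : 0 ≤ M
  · rw [← ENNReal.ofReal_mul hM, ← ENNReal.ofReal_add (by positivity) (by positivity),
      ← ENNReal.ofReal_add (by positivity) (by positivity)]
    apply le_of_eq
    congr 1
    ring
  · simp [ENNReal.ofReal_eq_zero.2 (not_le.mp hM).le]

/-- **Stub `stub_fluxSlicing`** (registered signature, verbatim): unsigned flux of `curl u` at most
`M` through every plane `R {x₂ = c}` implies the Giga–Miyakawa critical Morrey density bound
`∫_{B_r(x)} ‖curl u‖ ≤ 6 M r` on every ball. No regularity hypothesis on `u` (`curl u` is Borel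
measurable for every `u`). Proof: `‖w‖ ≤ Σᵢ |wᵢ|`, the ball lies in the three coordinate slabs of
width `2r`, and each slab integral of `|wᵢ|` is at most `2 r M` by Tonelli through the
measure-preserving slicing map `(c, y) ↦ Rᵢ (y₀, y₁, c)` (`lintegral_slab_le`). -/
theorem stub_fluxSlicing :
    ∀ (u : EuclideanSpace ℝ (Fin 3) → EuclideanSpace ℝ (Fin 3)) (M : ℝ),
      (∀ (R : EuclideanSpace ℝ (Fin 3) ≃ₗᵢ[ℝ] EuclideanSpace ℝ (Fin 3)) (c : ℝ),
          ∫⁻ y : EuclideanSpace ℝ (Fin 2),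
              ‖inner ℝ (curl u (R (WithLp.toLp 2 ![y 0, y 1, c]))) (R (EuclideanSpace.single 2 1))‖ₑ
            ≤ ENNReal.ofReal M) →
      ∀ (x : EuclideanSpace ℝ (Fin 3)) (r : ℝ), 0 < r →
        ∫⁻ y in Metric.ball x r, ‖curl u y‖ₑ ≤ ENNReal.ofReal (6 * M * r) := by
  intro u M hM x r hr
  have hf := measurable_enorm_curl_apply u
  -- each component: ball ⊆ slab, slab integral ≤ M · 2r
  have hcomp : ∀ i : Fin 3,
      ∫⁻ y in Metric.ball x r, ‖curl u y i‖ₑ ≤ ENNReal.ofReal M * ENNReal.ofReal (2 * r) := by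
    intro i
    have h := (lintegral_mono_set (μ := volume)
      (f := fun y : EuclideanSpace ℝ (Fin 3) => ‖curl u y i‖ₑ) (ball_subset_slab x r i)).trans
      (lintegral_slab_le hM i (x i - r) (x i + r))
    have e : x i + r - (x i - r) = 2 * r := by ring
    rwa [e] at h
  calc ∫⁻ y in Metric.ball x r, ‖curl u y‖ₑ
      ≤ ∫⁻ y in Metric.ball x r, (‖curl u y 0‖ₑ + ‖curl u y 1‖ₑ + ‖curl u y 2‖ₑ) :=
        lintegral_mono fun y => enorm_le_enorm_apply_add (curl u y)
    _ = (∫⁻ y in Metric.ball x r, ‖curl u y 0‖ₑ) + (∫⁻ y in Metric.ball x r, ‖curl u y 1‖ₑ)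
          + ∫⁻ y in Metric.ball x r, ‖curl u y 2‖ₑ := by
        have h01 : Measurable fun y : EuclideanSpace ℝ (Fin 3) => ‖curl u y 0‖ₑ + ‖curl u y 1‖ₑ :=
          (hf 0).add (hf 1)
        rw [lintegral_add_left h01, lintegral_add_left (hf 0)]
    _ ≤ ENNReal.ofReal M * ENNReal.ofReal (2 * r) + ENNReal.ofReal M * ENNReal.ofReal (2 * r)
          + ENNReal.ofReal M * ENNReal.ofReal (2 * r) :=
        add_le_add (add_le_add (hcomp 0) (hcomp 1)) (hcomp 2)
    _ ≤ ENNReal.ofReal (6 * M * r) := three_slabs_le M r hr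

end Summit.NavierStokesRegularity.NavierStokesRegularity.Theorems.PlanarFluxLiouville.Birth

end
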